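import Summits.BirchSwinnertonDyer.BirchSwinnertonDyer.Theorems.SignedLowerHalvesSmallImageLowerHalfBothSignsRttCharRoadE1LocalSquare
import Summits.BirchSwinnertonDyer.BirchSwinnertonDyer.Theorems.QuadraticBranchSignedControlEtaLayerSignedPoints
import Summits.BirchSwinnertonDyer.Rank1Residual.Additive.CyclotomicTowerSignedLocalTraceTransitive
import HarnessLib

/-!
# Route `SignedLowerHalves`, crux L `SmallImageLowerHalfBothSigns` (stmt-BirchSwinnertonDyer-23599), line `rtt_w3` v11 — brick D3-W, CONCRETE HALF,
# part 4 (memo `Lines/rtt_w3-MEMO-D3c-w3g17.md` §6 (W3)): THE TRACE COMPATIBILITY `hA'tr` — for a point `P ∈ E^ε(K_n·K_v)` (Kobayashi's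
# signed group over the `K`-tower, [Kobayashi2003] Def. 1.1) and `c ∈ Gal(K̄_E/k_n·E)` restricting OUTSIDE `galRange K` (a Frobenius at the
# inert prime), the quadratic trace `Q + cQ` of the transport `Q = transportPoints P ∈ E(Ē)` lies in `E^ε(k_n·E)` (the signed group over the
# `k`-tower): its `k`-tower traces are `R + cR` with `R` the transport of the `K`-tower traces of `P`.

Width seat `bsd-line-slh-p3-w3` g17 under LEAD `cruxlead-stmt-BirchSwinnertonDyer-23599` (cell `bsd-ssimc`; `--supports stmt-BirchSwinnertonDyer-23599 --as helper`).
THEOREMS ONLY (no definition, no named fact, no instance, no `sorry`). Data: those of `Rank1Residual/Additive/LocalSubgroupTransport` with ONE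
fixing hypothesis `hfixU` for `galRange K`, `ι₂` `E`-linear (`hι₂`), `galRange K` of index `2` (`hU`). Tools: the tree's generic pair trace
`localPairTraceOfEmb`, its re-indexing `localPairTraceOfEmb_eq_sum_of_bijective` (cell b2b), the transport of fixed points and traces BELOW
`galRange K` (`EtaLayer.transportPoints_mem_localFixedPointsOfEmb_iff`, `EtaLayer.transportPoints_localPairTraceOfEmb`, cell bsd-potss), and part 1
(p765739: `Λ = Λ' ∪ cΛ'`, `c² ∈ Λ'`, `c⁻¹Λ'c = Λ'`). Nothing at the completions; BSD / crux L are NOT proved here.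

* `smul_add_smul_eq_of_fixed` — a point `R` fixed by `Λ' = localSubgroupOfEmb (H ⊓ U) ι` has `R + cR` fixed by `Λ = localSubgroupOfEmb H ι`.
* ★ `localPairTraceOfEmb_add_smul_eq` — PURELY ON THE `k`-SIDE: `Tr_{Λ₁/Λ₂}(Q + cQ) = Tr_{Λ'₁/Λ'₂} Q + c • Tr_{Λ'₁/Λ'₂} Q` for `Q` fixed by `Λ'₂`,
  `H₂ ≤ H₁` normal, `U` of index `2`, `c ∈ Λ₂` restricting outside `U` (representatives of `Λ'₁/Λ'₂` ARE representatives of `Λ₁/Λ₂`; the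
  `c`-conjugated family is again a transversal of `Λ'₁/Λ'₂`).
* ★★ `transportPoints_add_smul_mem_signedLocalPointsOfEmb` — `hA'tr` of p765785: `transportPoints P + c • transportPoints P ∈ E^ε(k_n·E)`
  (`Kobayashi2003.signedLocalPointsOfEmb κ ι W ε n`) for `P ∈ E^ε(K_n·E')` (`… (κ.restrictOfFinrankEqTwo hp2 K hK2) ι' (W.baseChange K) ε n`).

References: [Kobayashi2003] Def. 1.1, §2 p. 4 (the trace maps `Tr_{n/m+1}`); [SerreGaloisCohomology1997] I §2.6 (b), II §1.1;
[NeukirchANT1999] II §9 (decomposition groups at inert primes).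
-/

set_option autoImplicit false
set_option linter.dupNamespace false -- D-0017: single-problem summit, the namespace repeats the problem name by design
noncomputable section

open scoped Classical

universe u

namespace Summit.BirchSwinnertonDyer.BirchSwinnertonDyer.Theorems.SmallImageCharSignedSelmer

open Literature.NumberTheory.EllipticCurves Literature.NumberTheory.GaloisRepresentations Field
  Summit.BirchSwinnertonDyer.Rank1Residual.Additive Summit.BirchSwinnertonDyer.Rank1Residual.Additive.LocalTransport

/-! ## §1 On the `k`-side: the quadratic trace `Q + cQ` and the pair traces -/

section KSide

variable {k : Type u} [Field k] {H H₁ H₂ U : Subgroup (absoluteGaloisGroup k)} {E : Type u} [Field E] [Algebra k E]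
  (ι : AlgebraicClosure k →ₐ[k] AlgebraicClosure E) (W : WeierstrassCurve k)

/-- **`R + cR` is fixed by `Λ = localSubgroupOfEmb H ι`** when `R` is fixed by `Λ' = localSubgroupOfEmb (H ⊓ U) ι`, `U` has index `2`,
`c ∈ Λ` restricts outside `U` (`Λ = Λ' ∪ cΛ'`, `c² ∈ Λ'`, `c⁻¹Λ'c ⊆ Λ'`). [cite: SerreGaloisCohomology1997, I §2.6 (b)] -/
theorem smul_add_smul_eq_of_fixed [H.Normal] (hU : U.index = 2) {c : absoluteGaloisGroup E} (hc : c ∈ localSubgroupOfEmb H ι)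
    (hcU : resGalOfEmb ι c ∉ U) {R : localPoints W E} (hR : ∀ x ∈ localSubgroupOfEmb (H ⊓ U) ι, x • R = R)
    (b : absoluteGaloisGroup E) (hb : b ∈ localSubgroupOfEmb H ι) : b • (R + c • R) = R + c • R := by
  rcases mem_or_inv_mul_mem_localSubgroupOfEmb_inf hU hc hcU b hb with hb' | hb'
  · have e : b • (c • R) = c • ((c⁻¹ * b * c) • R) := by rw [← mul_smul, ← mul_smul]; congr 1; group
    rw [smul_add, hR b hb', e, hR _ (conj_mem_localSubgroupOfEmb_inf hU hc b hb')]
  · have e1 : b • R = c • ((c⁻¹ * b) • R) := by rw [← mul_smul]; congr 1; group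
    have e2 : b • (c • R) = (c * c) • ((c⁻¹ * (c⁻¹ * b) * c) • R) := by rw [← mul_smul, ← mul_smul]; congr 1; group
    rw [smul_add, e1, hR _ hb', e2, hR _ (conj_mem_localSubgroupOfEmb_inf hU hc _ hb'), hR _ (mul_self_mem_localSubgroupOfEmb_inf hU hc), add_comm]

/-- **Representatives of `Λ'₁/Λ'₂` are representatives of `Λ₁/Λ₂`** (`Λᵢ = localSubgroupOfEmb Hᵢ ι`, `Λ'ᵢ = localSubgroupOfEmb (Hᵢ ⊓ U) ι`,
`H₂ ≤ H₁`, `U` of index `2`, some `c ∈ Λ₂` restricting outside `U`): `r ↦ r.out Λ₂` is a bijection `Λ'₁/Λ'₂ → Λ₁/Λ₂` — injective because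
`Λ₂ ⊓ Λ'₁ ≤ Λ'₂`, onto because `Λ₁ = Λ'₁ ∪ cΛ'₁` and `y⁻¹c⁻¹y ∈ Λ₂`. [cite: SerreGaloisCohomology1997, I §2.6 (b)] -/
theorem bijective_mk_out_inf [H₂.Normal] (h21 : H₂ ≤ H₁) (hU : U.index = 2) {c : absoluteGaloisGroup E}
    (hc : c ∈ localSubgroupOfEmb H₂ ι) (hcU : resGalOfEmb ι c ∉ U) :
    Function.Bijective fun r : localSubgroupOfEmb (H₁ ⊓ U) ι ⧸
        (localSubgroupOfEmb (H₂ ⊓ U) ι).subgroupOf (localSubgroupOfEmb (H₁ ⊓ U) ι) ↦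
      (QuotientGroup.mk (Subgroup.inclusion (localSubgroupOfEmb_inf_le H₁ U ι) r.out) :
        localSubgroupOfEmb H₁ ι ⧸ (localSubgroupOfEmb H₂ ι).subgroupOf (localSubgroupOfEmb H₁ ι)) := by
  haveI hΛ₂n : (localSubgroupOfEmb H₂ ι).Normal := normal_localSubgroupOfEmb ι H₂
  have hc₁ : c ∈ localSubgroupOfEmb H₁ ι := Subgroup.comap_mono h21 hc
  constructor
  · intro r₁ r₂ h
    have h' := QuotientGroup.eq.1 h
    rw [Subgroup.mem_subgroupOf, Subgroup.coe_mul, Subgroup.coe_inv, Subgroup.coe_inclusion, Subgroup.coe_inclusion] at h'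
    have hU' : resGalOfEmb ι (((r₁.out)⁻¹ * r₂.out : localSubgroupOfEmb (H₁ ⊓ U) ι) : absoluteGaloisGroup E) ∈ U :=
      ((mem_localSubgroupOfEmb_inf_iff _).1 ((r₁.out)⁻¹ * r₂.out).2).2
    rw [Subgroup.coe_mul, Subgroup.coe_inv] at hU'
    rw [← QuotientGroup.out_eq' r₁, ← QuotientGroup.out_eq' r₂, QuotientGroup.eq, Subgroup.mem_subgroupOf, Subgroup.coe_mul,
      Subgroup.coe_inv, mem_localSubgroupOfEmb_inf_iff]
    exact ⟨h', hU'⟩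
  · intro q
    obtain ⟨y, rfl⟩ := QuotientGroup.mk_surjective q
    -- a representative `y'` of the coset `yΛ₂` inside `Λ'₁`
    obtain ⟨y', hy', hyy'⟩ : ∃ y' : absoluteGaloisGroup E, y' ∈ localSubgroupOfEmb (H₁ ⊓ U) ι ∧
        (y : absoluteGaloisGroup E)⁻¹ * y' ∈ localSubgroupOfEmb H₂ ι := by
      rcases mem_or_inv_mul_mem_localSubgroupOfEmb_inf hU hc₁ hcU (y : absoluteGaloisGroup E) y.2 with h | h
      · exact ⟨y, h, by rw [inv_mul_cancel]; exact one_mem _⟩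
      · refine ⟨c⁻¹ * y, h, ?_⟩
        have h2 := hΛ₂n.conj_mem c⁻¹ (inv_mem hc) (y : absoluteGaloisGroup E)⁻¹
        rwa [inv_inv, mul_assoc] at h2
    refine ⟨QuotientGroup.mk ⟨y', hy'⟩, ?_⟩
    obtain ⟨z, hz⟩ := QuotientGroup.mk_out_eq_mul ((localSubgroupOfEmb (H₂ ⊓ U) ι).subgroupOf (localSubgroupOfEmb (H₁ ⊓ U) ι))
      (⟨y', hy'⟩ : localSubgroupOfEmb (H₁ ⊓ U) ι)
    have hz2 : ((z : localSubgroupOfEmb (H₁ ⊓ U) ι) : absoluteGaloisGroup E) ∈ localSubgroupOfEmb H₂ ι :=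
      localSubgroupOfEmb_inf_le H₂ U ι (Subgroup.mem_subgroupOf.1 z.2)
    show (QuotientGroup.mk (Subgroup.inclusion (localSubgroupOfEmb_inf_le H₁ U ι)
        (QuotientGroup.mk (⟨y', hy'⟩ : localSubgroupOfEmb (H₁ ⊓ U) ι) : _ ⧸ _).out) : _ ⧸ _) = QuotientGroup.mk y
    rw [hz, QuotientGroup.eq, Subgroup.mem_subgroupOf, Subgroup.coe_mul, Subgroup.coe_inv, Subgroup.coe_inclusion, Subgroup.coe_mul]
    have e : ((y' : absoluteGaloisGroup E) * (z : localSubgroupOfEmb (H₁ ⊓ U) ι))⁻¹ * (y : absoluteGaloisGroup E) =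
        ((y : absoluteGaloisGroup E)⁻¹ * y' * (z : localSubgroupOfEmb (H₁ ⊓ U) ι))⁻¹ := by group
    rw [e]
    exact inv_mem (mul_mem hyy' hz2)

/-- **Conjugating representatives by `c`**: `r ↦ (c⁻¹ · r.out · c) Λ'₂` is a bijection of `Λ'₁/Λ'₂` (`c ∈ Λ₂` normalises `Λ'₁` and `Λ'₂`;
injective on a finite set). [cite: SerreGaloisCohomology1997, I §2.6 (b)] -/
theorem bijective_mk_conj_out_inf [H₁.Normal] [H₂.Normal] [(H₂ ⊓ U).FiniteIndex] (h21 : H₂ ≤ H₁) (hU : U.index = 2)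
    {c : absoluteGaloisGroup E} (hc : c ∈ localSubgroupOfEmb H₂ ι) :
    Function.Bijective fun r : localSubgroupOfEmb (H₁ ⊓ U) ι ⧸
        (localSubgroupOfEmb (H₂ ⊓ U) ι).subgroupOf (localSubgroupOfEmb (H₁ ⊓ U) ι) ↦
      (QuotientGroup.mk (⟨c⁻¹ * (r.out : absoluteGaloisGroup E) * c,
          conj_mem_localSubgroupOfEmb_inf hU (Subgroup.comap_mono h21 hc : c ∈ localSubgroupOfEmb H₁ ι) _ r.out.2⟩ :
          localSubgroupOfEmb (H₁ ⊓ U) ι) :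
        localSubgroupOfEmb (H₁ ⊓ U) ι ⧸ (localSubgroupOfEmb (H₂ ⊓ U) ι).subgroupOf (localSubgroupOfEmb (H₁ ⊓ U) ι)) := by
  refine Finite.injective_iff_bijective.1 fun r₁ r₂ h ↦ ?_
  have h' := QuotientGroup.eq.1 h
  rw [Subgroup.mem_subgroupOf, Subgroup.coe_mul, Subgroup.coe_inv] at h'
  have h'' := conj_mem_localSubgroupOfEmb_inf hU (inv_mem hc) _ h'
  have e : c⁻¹⁻¹ * ((c⁻¹ * (r₁.out : absoluteGaloisGroup E) * c)⁻¹ * (c⁻¹ * (r₂.out : absoluteGaloisGroup E) * c)) * c⁻¹ =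
      (r₁.out : absoluteGaloisGroup E)⁻¹ * (r₂.out : absoluteGaloisGroup E) := by group
  rw [e] at h''
  rw [← QuotientGroup.out_eq' r₁, ← QuotientGroup.out_eq' r₂, QuotientGroup.eq, Subgroup.mem_subgroupOf, Subgroup.coe_mul, Subgroup.coe_inv]
  exact h''

/-- ★ **The quadratic trace and the pair traces** (`k`-side only). For `H₂ ≤ H₁` normal in `Γ_k`, `U ≤ Γ_k` of index `2`, `c ∈ Λ₂`
restricting outside `U` and `Q ∈ E(Ē)` fixed by `Λ'₂ = localSubgroupOfEmb (H₂ ⊓ U) ι`: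
`Tr_{Λ₁/Λ₂}(Q + cQ) = Tr_{Λ'₁/Λ'₂} Q + c • Tr_{Λ'₁/Λ'₂} Q`. Proof: index `Tr_{Λ₁/Λ₂}` by `Λ'₁/Λ'₂` (`bijective_mk_out_inf`), split,
and re-index the `cQ`-half by the `c`-conjugated transversal (`r.out·c = c·(c⁻¹ r.out c)`, `bijective_mk_conj_out_inf`). In D3-W: `H₁ = Gal(k̄/k_{m+1})`,
`H₂ = Gal(k̄/k_n)`, `U = galRange K`, `Λ'ᵢ ↔ Gal(K̄_v/K_i K_v)`. [cite: Kobayashi2003, §2 p. 4] [cite: SerreGaloisCohomology1997, I §2.6 (b)] -/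
theorem localPairTraceOfEmb_add_smul_eq [H₁.Normal] [H₂.Normal] [H₂.FiniteIndex] [(H₂ ⊓ U).FiniteIndex] (h21 : H₂ ≤ H₁)
    (hU : U.index = 2) {c : absoluteGaloisGroup E} (hc : c ∈ localSubgroupOfEmb H₂ ι) (hcU : resGalOfEmb ι c ∉ U)
    {Q : localPoints W E} (hQ : Q ∈ localFixedPointsOfEmb ι W (H₂ ⊓ U)) :
    localPairTraceOfEmb ι W H₁ H₂ (Q + c • Q) =
      localPairTraceOfEmb ι W (H₁ ⊓ U) (H₂ ⊓ U) Q + c • localPairTraceOfEmb ι W (H₁ ⊓ U) (H₂ ⊓ U) Q := by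
  have hQc : Q + c • Q ∈ localFixedPointsOfEmb ι W H₂ :=
    (mem_localFixedPointsOfEmb_iff ι W H₂ _).2
      (smul_add_smul_eq_of_fixed ι W hU hc hcU ((mem_localFixedPointsOfEmb_iff ι W _ Q).1 hQ))
  haveI : Fintype (localSubgroupOfEmb (H₁ ⊓ U) ι ⧸ (localSubgroupOfEmb (H₂ ⊓ U) ι).subgroupOf (localSubgroupOfEmb (H₁ ⊓ U) ι)) :=
    Fintype.ofFinite _
  rw [localPairTraceOfEmb_eq_sum_of_bijective ι W H₁ H₂ hQc _ (bijective_mk_out_inf ι h21 hU hc hcU)]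
  simp only [Subgroup.coe_inclusion, smul_add, Finset.sum_add_distrib]
  congr 1
  · exact (localPairTraceOfEmb_apply ι W (H₁ ⊓ U) (H₂ ⊓ U) Q).symm
  · rw [localPairTraceOfEmb_eq_sum_of_bijective ι W (H₁ ⊓ U) (H₂ ⊓ U) hQ _ (bijective_mk_conj_out_inf ι h21 hU hc), Finset.smul_sum]
    refine Finset.sum_congr rfl fun r _ ↦ ?_
    rw [← mul_smul, ← mul_smul]
    congr 1
    group

end KSide

/-! ## §2 The transport: `hA'tr` -/

section Transport

variable {k : Type u} [Field k] [NumberField k] {p : ℕ} [hp : Fact p.Prime] (hp2 : p ≠ 2) (κ : ZpExtension k p)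
  (K : Type u) [Field K] [NumberField K] [Algebra k K] (hK2 : Module.finrank k K = 2)
  {E : Type u} [Field E] [Algebra k E] {E' : Type u} [Field E'] [Algebra K E'] [Algebra E E'] [Algebra k E'] [IsScalarTower k K E']
  (ι : AlgebraicClosure k →ₐ[k] AlgebraicClosure E) (ι₂ : AlgebraicClosure E ≃+* AlgebraicClosure E')
  (ι' : AlgebraicClosure K →ₐ[K] AlgebraicClosure E')
  (hcompat : ∀ z : AlgebraicClosure k, ι' (closureEmb (K := k) K z) = ι₂ (ι z))
  (hι₂ : ∀ a : E, ι₂ (algebraMap E (AlgebraicClosure E) a) = algebraMap E' (AlgebraicClosure E') (algebraMap E E' a))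
  (hfixU : ∀ h : absoluteGaloisGroup E, resGalOfEmb ι h ∈ galRange (K := k) K → ∀ y : E',
    (show AlgebraicClosure E ≃ₐ[E] AlgebraicClosure E from h) (ι₂.symm (algebraMap E' (AlgebraicClosure E') y)) =
      ι₂.symm (algebraMap E' (AlgebraicClosure E') y))
  (hU : (galRange (K := k) K).index = 2) (W : WeierstrassCurve k)

/-- `hHH'` at layer `j`: an element of `Γ_K` restricting into `Gal(k̄/k_j) ⊓ galRange K` lies in `Gal(K̄/K_j)`. [cite: Washington1997, §13.1] -/
theorem hHH'_layer (j : ℕ) : ∀ τ : absoluteGaloisGroup K,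
    resGal (K := k) K τ ∈ κ.layerSubgroup j ⊓ galRange (K := k) K → τ ∈ (κ.restrictOfFinrankEqTwo hp2 K hK2).layerSubgroup j := by
  intro τ hτ
  rw [layerSubgroup_restrictOfFinrankEqTwo, Subgroup.mem_comap]
  exact (Subgroup.mem_inf.1 hτ).1

/-- `hH'H` at layer `j`: `res(Gal(K̄/K_j)) ⊆ Gal(k̄/k_j) ⊓ galRange K`. [cite: Washington1997, §13.1] -/
theorem hH'H_layer (j : ℕ) : ∀ τ : absoluteGaloisGroup K,
    τ ∈ (κ.restrictOfFinrankEqTwo hp2 K hK2).layerSubgroup j → resGal (K := k) K τ ∈ κ.layerSubgroup j ⊓ galRange (K := k) K := by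
  intro τ hτ
  rw [layerSubgroup_restrictOfFinrankEqTwo, Subgroup.mem_comap] at hτ
  exact Subgroup.mem_inf.2 ⟨hτ, (mem_galRange_iff K _).2 ⟨τ, rfl⟩⟩

include hι₂ hfixU in
/-- **Fixed points cross the square**: `transportPoints P` is fixed by `Λ'_j = localSubgroupOfEmb (Gal(k̄/k_j) ⊓ galRange K) ι` iff `P` is fixed by
`Gal(K̄_{E'}/K_j E')` (the tree's `EtaLayer.transportPoints_mem_localFixedPointsOfEmb_iff` at the layers). [cite: SerreGaloisCohomology1997, II §1.1] -/
theorem transportPoints_mem_localFixedPointsOfEmb_inf_iff (j : ℕ) (P : localPoints (W.baseChange K) E') :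
    transportPoints K ι ι₂ ι' hcompat W P ∈ localFixedPointsOfEmb ι W (κ.layerSubgroup j ⊓ galRange (K := k) K) ↔
      P ∈ localFixedPointsOfEmb ι' (W.baseChange K) ((κ.restrictOfFinrankEqTwo hp2 K hK2).layerSubgroup j) :=
  EtaLayer.transportPoints_mem_localFixedPointsOfEmb_iff K ι ι₂ ι' hcompat (algebraMap E E') hι₂ hfixU W
    (κ.layerSubgroup j ⊓ galRange (K := k) K) ((κ.restrictOfFinrankEqTwo hp2 K hK2).layerSubgroup j) inf_le_right
    (hHH'_layer hp2 κ K hK2 j) (hH'H_layer hp2 κ K hK2 j) P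

include hι₂ hfixU in
/-- **Traces cross the square**: `transportPoints (Tr^K_{n/m} P) = Tr_{Λ'_m/Λ'_n} (transportPoints P)` for `P` fixed by `Gal(K̄_{E'}/K_n E')`
(the tree's `EtaLayer.transportPoints_localPairTraceOfEmb` at the layers). [cite: Kobayashi2003, §2 p. 4] [cite: SerreGaloisCohomology1997, II §1.1] -/
theorem transportPoints_localPairTraceOfEmb_layer (m n : ℕ) [(κ.layerSubgroup n ⊓ galRange (K := k) K).FiniteIndex]
    [((κ.restrictOfFinrankEqTwo hp2 K hK2).layerSubgroup n).FiniteIndex] {P : localPoints (W.baseChange K) E'}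
    (hP : P ∈ localFixedPointsOfEmb ι' (W.baseChange K) ((κ.restrictOfFinrankEqTwo hp2 K hK2).layerSubgroup n)) :
    transportPoints K ι ι₂ ι' hcompat W (localPairTraceOfEmb ι' (W.baseChange K) ((κ.restrictOfFinrankEqTwo hp2 K hK2).layerSubgroup m)
        ((κ.restrictOfFinrankEqTwo hp2 K hK2).layerSubgroup n) P) =
      localPairTraceOfEmb ι W (κ.layerSubgroup m ⊓ galRange (K := k) K) (κ.layerSubgroup n ⊓ galRange (K := k) K)
        (transportPoints K ι ι₂ ι' hcompat W P) :=
  EtaLayer.transportPoints_localPairTraceOfEmb K ι ι₂ ι' hcompat (algebraMap E E') hι₂ hfixU W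
    (κ.layerSubgroup m ⊓ galRange (K := k) K) (κ.layerSubgroup n ⊓ galRange (K := k) K)
    ((κ.restrictOfFinrankEqTwo hp2 K hK2).layerSubgroup m) ((κ.restrictOfFinrankEqTwo hp2 K hK2).layerSubgroup n)
    inf_le_right inf_le_right (hHH'_layer hp2 κ K hK2 m) (hH'H_layer hp2 κ K hK2 m) (hHH'_layer hp2 κ K hK2 n) (hH'H_layer hp2 κ K hK2 n) hP

include hι₂ hfixU hU in
/-- ★★ **`hA'tr` (D3-W concrete, memo §6 (W3)).** Let `P ∈ E^ε(K_n·E')` (Kobayashi's signed local points of `W_K` over the layers of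
`κ_K = κ.restrictOfFinrankEqTwo`, at `ι'`) and `c ∈ Gal(K̄_E/k_n E)` with `res_ι c ∉ galRange K`. Then
`transportPoints P + c • transportPoints P ∈ E^ε(k_n·E)`. Indeed `Q = transportPoints P` is fixed by `Λ'_n`, so `Q + cQ` is fixed by `Λ_n`
(`smul_add_smul_eq_of_fixed`); and for `m < n` of sign `ε`, `Tr_{n/m+1}(Q + cQ) = R + cR` with `R = Tr_{Λ'_{m+1}/Λ'_n} Q = transportPoints (Tr^K_{n/m+1} P)`
(`localPairTraceOfEmb_add_smul_eq`, `transportPoints_localPairTraceOfEmb_layer`), which is fixed by `Λ'_m` because `Tr^K_{n/m+1} P ∈ E(K_m·E')`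
(Def. 1.1 for `P`), hence `R + cR ∈ E(k_m·E)`. With `A = E^ε(k_n·E)`, `A' = transportPoints(E^ε(K_n·E'))` this is the hypothesis `hA'tr` of
`mem_localKummerOverOfEmb_of_kummer_on_index_two_of_trace` (p765785). [cite: Kobayashi2003, Def. 1.1, §2 p. 4] [cite: SerreGaloisCohomology1997, II §1.1] -/
theorem transportPoints_add_smul_mem_signedLocalPointsOfEmb (ε : ℤˣ) (n : ℕ) {c : absoluteGaloisGroup E}
    (hc : c ∈ localSubgroupOfEmb (κ.layerSubgroup n) ι) (hcU : resGalOfEmb ι c ∉ galRange (K := k) K)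
    {P : localPoints (W.baseChange K) E'}
    (hP : P ∈ Kobayashi2003.signedLocalPointsOfEmb (κ.restrictOfFinrankEqTwo hp2 K hK2) ι' (W.baseChange K) ε n) :
    transportPoints K ι ι₂ ι' hcompat W P + c • transportPoints K ι ι₂ ι' hcompat W P ∈ Kobayashi2003.signedLocalPointsOfEmb κ ι W ε n := by
  haveI hUfin : (galRange (K := k) K).FiniteIndex := ⟨by rw [hU]; decide⟩
  rw [Kobayashi2003.mem_signedLocalPointsOfEmb_iff] at hP ⊢
  have hQ : transportPoints K ι ι₂ ι' hcompat W P ∈ localFixedPointsOfEmb ι W (κ.layerSubgroup n ⊓ galRange (K := k) K) :=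
    (transportPoints_mem_localFixedPointsOfEmb_inf_iff hp2 κ K hK2 ι ι₂ ι' hcompat hι₂ hfixU W n P).2 hP.1
  refine ⟨?_, fun m hm hε ↦ ?_⟩
  · rw [localLayerPointsOfEmb_eq, mem_localFixedPointsOfEmb_iff]
    exact smul_add_smul_eq_of_fixed ι W hU hc hcU ((mem_localFixedPointsOfEmb_iff ι W _ _).1 hQ)
  · have hPm := hP.2 m hm hε
    rw [localTraceOfEmb_eq_localPairTraceOfEmb] at hPm ⊢
    rw [localPairTraceOfEmb_add_smul_eq ι W (κ.layerSubgroup_antitone (Nat.succ_le_of_lt hm)) hU hc hcU hQ,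
      ← transportPoints_localPairTraceOfEmb_layer hp2 κ K hK2 ι ι₂ ι' hcompat hι₂ hfixU W (m + 1) n hP.1,
      localLayerPointsOfEmb_eq, mem_localFixedPointsOfEmb_iff]
    have hR := (mem_localFixedPointsOfEmb_iff ι W _ _).1
      ((transportPoints_mem_localFixedPointsOfEmb_inf_iff hp2 κ K hK2 ι ι₂ ι' hcompat hι₂ hfixU W m _).2 hPm)
    exact smul_add_smul_eq_of_fixed ι W hU (Subgroup.comap_mono (κ.layerSubgroup_antitone hm.le) hc) hcU hR

end Transport

end Summit.BirchSwinnertonDyer.BirchSwinnertonDyer.Theorems.SmallImageCharSignedSelmer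

end
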